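import Literature.Combinatorics.Additive.NeumannTPPInequality
import Summits.MatrixMultiplication.OmegaCensus.DihedralTPPFamilyVolume
import HarnessLib

/-!
# The `(2,2,c)` pattern ceiling for TPP triples and its exact attainment in `D_{6m}`

ω-census, family (b3) (single TPP triples in small groups).  Framing: lottery ticket; floor = certified
bounds/negative ranges.

From Neumann's inequality `|U|(|S|+|T|-1) ≤ |G|` (Neumann 2011, Obs. 3.1; tree theorem
`TripleProductProperty.card_mul_le_neumann₃`) every TPP triple with `|S|, |T| ≥ 2` has `3|U| ≤ |G|`, so a
triple of size pattern `(2,2,c)` has volume at most `4⌊|G|/3⌋`.  The census's empirical *dihedral law*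
`β(D_{2n}) = 4⌊2n/3⌋` (confirmed by SAT/DRAT for `4 ≤ n ≤ 19`) says that in dihedral groups NO pattern does
better than this `(2,2,c)` ceiling; here we record the kernel half: the ceiling itself (all groups) and its
exact attainment `8m = 4⌊6m/3⌋` in `D_{6m} = DihedralGroup (3m)` by the uniform family of
`DihedralTPPFamilyGeneral.lean`, whose third set therefore has exactly `2m` elements.
-/

namespace Summit.MatrixMultiplication.OmegaCensus

open Literature.Combinatorics.Additive Finset

variable {G : Type*} [Group G] [DecidableEq G] [Fintype G]

/-- **`(2,2,c)` ceiling.** If `(S,T,U)` has the triple product property and `|S|, |T| ≥ 2` then `3|U| ≤ |G|`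
(Neumann 2011 Obs. 3.1 with the roles rotated: `|U|(|S|+|T|-1) ≤ |G|`). [folklore] -/
theorem three_mul_card_le_of_tpp {S T U : Finset G} (h : TripleProductProperty S T U)
    (hS : 2 ≤ S.card) (hT : 2 ≤ T.card) : 3 * U.card ≤ Fintype.card G := by
  rcases U.eq_empty_or_nonempty with hU | hU
  · simp [hU]
  have hSne : S.Nonempty := card_pos.mp (by omega)
  have hTne : T.Nonempty := card_pos.mp (by omega)
  have key := h.card_mul_le_neumann₃ hSne hTne hU
  calc 3 * U.card = U.card * 3 := Nat.mul_comm _ _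
    _ ≤ U.card * (S.card + T.card - 1) := Nat.mul_le_mul_left _ (by omega)
    _ ≤ Fintype.card G := key

/-- The volume of a TPP triple of size pattern `(2,2,c)` is at most `4⌊|G|/3⌋`. [folklore] -/
theorem tpp_volume_two_two_le {S T U : Finset G} (h : TripleProductProperty S T U)
    (hS : S.card = 2) (hT : T.card = 2) :
    S.card * T.card * U.card ≤ 4 * (Fintype.card G / 3) := by
  have key := three_mul_card_le_of_tpp h hS.ge hT.ge
  rw [hS, hT]; omega

/-- **Exact attainment in `D_{6m}`.** The dihedral family `S = {1, s}`, `T = {1, s r}`,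
`U = ⟨r³⟩ ∪ s r² ⟨r³⟩` of `DihedralTPPFamilyGeneral.lean` has `|S| = |T| = 2`, `|U| = 2m` exactly, and volume
`8m = 4⌊|D_{6m}|/3⌋`: the `(2,2,c)` ceiling is attained with equality in every dihedral group of order
divisible by `6`. [folklore] -/
theorem dihedral_family_volume_eq (m : ℕ) [NeZero m] :
    ∃ S T U : Finset (DihedralGroup (3 * m)), TripleProductProperty S T U ∧ S.card = 2 ∧ T.card = 2 ∧
      U.card = 2 * m ∧ S.card * T.card * U.card = 4 * (Fintype.card (DihedralGroup (3 * m)) / 3) := by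
  have htpp := dihedral_family_tpp m
  have hS : ({DihedralGroup.r 0, DihedralGroup.sr 0} : Finset (DihedralGroup (3 * m))).card = 2 := by
    rw [card_insert_of_notMem (by rw [mem_singleton]; intro h; cases h), card_singleton]
  have hT : ({DihedralGroup.r 0, DihedralGroup.sr 1} : Finset (DihedralGroup (3 * m))).card = 2 := by
    rw [card_insert_of_notMem (by rw [mem_singleton]; intro h; cases h), card_singleton]
  have hdisj : Disjoint ((univ : Finset (ZMod (3 * m))).image fun j => DihedralGroup.r (3 * j))
      ((univ : Finset (ZMod (3 * m))).image fun j => DihedralGroup.sr (2 + 3 * j)) := by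
    rw [disjoint_left]
    intro x hx hx'
    simp only [mem_image, mem_univ, true_and] at hx hx'
    obtain ⟨j, rfl⟩ := hx
    obtain ⟨j', h⟩ := hx'
    cases h
  have hU := card_union_of_disjoint hdisj
  have h1 := card_image_r_three_mul m
  have h2 := card_image_sr_three_mul m
  have hup := three_mul_card_le_of_tpp htpp hS.ge hT.ge
  have hG : Fintype.card (DihedralGroup (3 * m)) = 2 * (3 * m) := DihedralGroup.card
  rw [hG, hU] at hup
  refine ⟨_, _, _, htpp, hS, hT, ?_, ?_⟩
  · rw [hU]
    omega
  · rw [hS, hT, hG, hU]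
    omega

end Summit.MatrixMultiplication.OmegaCensus
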